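import Literature.Probability.RandomPlanarGeometry.HexSAWLemma2
import HarnessLib

/-!
# One-sided arrival mass in the Duminil-Copin–Smirnov strip: `A⁺, A⁻ ≤ 1/(2 cos(3π/8))`

Topic `Literature/Probability/RandomPlanarGeometry`.  Source: H. Duminil-Copin, S. Smirnov, *The
connective constant of the honeycomb lattice equals `√(2+√2)`*, Ann. of Math. 175 (2012),
1653–1665 (arXiv:1007.0575), §3, proof of Lemma 2: summing the vertex relation over `V(S_{T,L})`
gives the COMPLEX identity (5) `0 = -Σ_{α} F + Σ_{β} F + j Σ_{ε} F + j̄ Σ_{ε̄} F` (in the tree: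
`HV.boundary_sum`), whose REAL part is Lemma 2, `1 = c_α A + B + c_ε E`
(`DuminilCopinSmirnov2012_lemma2_holds`, `HexSAWLemma2.lean`).

This file takes the IMAGINARY part as well.  Split the arrival mass on `α ∖ {a}` by the side of
`a` on which the walk exits, `A = A⁺ + A⁻` (exit column `k > 0` / `k < 0`; windings `-π` / `+π`),
and the mass through the two oblique cuts, `E = E_ℓ + E_r` (windings `+2π/3` / `-2π/3`).  The
imaginary part of (5) reads `sin(3π/8)·(A⁻ − A⁺) + sin(π/4)·(E_ℓ − E_r) = 0`
(`strip_imaginary_identity`), and together with Lemma 2 (and `B ≥ 0`, `sin(π/4) = cos(π/4)`,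
`sin(3π/8) > cos(3π/8)`) it yields the SHARP one-sided bound

  `A⁺ ≤ 1/(2 cos(3π/8))` and `A⁻ ≤ 1/(2 cos(3π/8))`   (`strip_halfSide_arrival_le`)

for every strip `S_{T,L}`, `T ≥ 1` — half of the bound `A ≤ 1/cos(3π/8)` that Lemma 2 gives for
the two sides together, WITHOUT using the mirror symmetry of the strip.  (Equality is approached
as `T, L → ∞`: it is the half-plane arrival mass on one side of the root.)  Consumers: positive-mass
budgets for the parafermionic developing map near a pinned flat root (crux `BoundaryClosureR`,
stmt-CriticalPhenomena-14004, line `pick-half-plane`: "Claim D at the far end of the root's floor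
⟺ `Σ_{west} Z ≤ 1/(2cos(3π/8))`").

No new definition: the one-sided masses are written as explicit filtered sums.
-/

noncomputable section

open Finset

namespace Literature.Probability.RandomPlanarGeometry.SAW

namespace HV

open Real Hopf

variable {T L : ℕ}

/-! ### Imaginary parts of the boundary terms -/

/-- `sin(-3θ) = sin(3π/8)` (`-3θ = 5π/8`). [folklore] -/
theorem sin_neg_three_mul_θ₅ : Real.sin (-3 * θ₅) = Real.sin (3 * π / 8) := by
  rw [show -3 * θ₅ = π - 3 * π / 8 by simp only [θ₅]; ring, Real.sin_pi_sub]

/-- `sin(3θ) = -sin(3π/8)`. [folklore] -/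
theorem sin_three_mul_θ₅ : Real.sin (3 * θ₅) = -Real.sin (3 * π / 8) := by
  rw [← sin_neg_three_mul_θ₅, ← Real.sin_neg]; ring_nf

/-- `sin(18 θ) = sin(π/4)` (`18θ = -15π/4`). [folklore] -/
theorem sin_eighteen_mul_θ₅ : Real.sin (18 * θ₅) = Real.sin (π / 4) := by
  rw [show 18 * θ₅ = π / 4 - (2 : ℤ) * (2 * π) by simp only [θ₅]; push_cast; ring,
    Real.sin_sub_int_mul_two_pi]

/-- `sin(30 θ) = -sin(π/4)` (`30θ = -25π/4`). [folklore] -/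
theorem sin_thirty_mul_θ₅ : Real.sin (30 * θ₅) = -Real.sin (π / 4) := by
  rw [show 30 * θ₅ = -(π / 4) - (3 : ℤ) * (2 * π) by simp only [θ₅]; push_cast; ring,
    Real.sin_sub_int_mul_two_pi, Real.sin_neg]

/-- **Boundary term on `α ∖ {a}`, imaginary part**: `-sign(k)·sin(3π/8)`, `k` the exit column
(winding `-π` for `k > 0`, `+π` for `k < 0`).
[cite: DuminilCopinSmirnov2012, proof of Lemma 2 (windings ∓π on the two parts of α)] -/
theorem boundaryTerm_im_of_isAlphaDart {P : List HV} (hP : IsMidWalk (stripV T L) P)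
    (hα : IsAlphaDart (finalDart P)) :
    (edir (finalDart P).1 (finalDart P).2 * lam ^ pturn P / emb (-1, 2)).im =
      -(Int.sign (finalDart P).1.1 : ℝ) * Real.sin (3 * π / 8) := by
  obtain ⟨hk, h0⟩ := pturn_of_isAlphaDart hP hα
  rcases hP.trivial_or_exists with rfl | ⟨l, u, hl, rfl⟩
  · exact absurd hα.1 (by simp [finalDart, wOut])
  rw [h0, finalDart_cons_append hl]
  rw [finalDart_cons_append hl] at hα hk
  obtain ⟨h1, h2, h3⟩ := hα
  dsimp only at h1 h2 h3 hk ⊢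
  have he : edir (l.getLast hl) u = -emb (-1, 2) := by
    rw [edir, h3,
      show pos (l.getLast hl) = (3 * (l.getLast hl).1 + 1, 1) by simp [pos, h2, h1]]
    simp only [pos, if_true, ← emb_neg]
    congr 1; simp only [Prod.mk_sub_mk, Prod.neg_mk, Prod.mk.injEq]; constructor <;> ring
  rw [he, neg_mul, neg_div, mul_div_right_comm, div_self emb_neg_one_two_ne_zero, one_mul,
    Complex.neg_im, lam_zpow_im]
  rcases lt_or_gt_of_ne hk with hk' | hk'
  · rw [Int.sign_eq_neg_one_of_neg hk', show (((-(3 * (-1)) : ℤ) : ℝ)) * θ₅ = -(-3 * θ₅) by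
      push_cast; ring, Real.sin_neg, sin_neg_three_mul_θ₅]
    push_cast; ring
  · rw [Int.sign_eq_one_of_pos hk', show (((-(3 * 1) : ℤ) : ℝ)) * θ₅ = -3 * θ₅ by push_cast; ring,
      sin_neg_three_mul_θ₅]
    push_cast; ring

/-- **Boundary term on `ε ∪ ε̄`, imaginary part**: `+sin(π/4)` through the left cut (winding
`+2π/3`), `-sin(π/4)` through the right cut (winding `-2π/3`).
[cite: DuminilCopinSmirnov2012, proof of Lemma 2 (windings ±2π/3 on ε, ε̄)] -/
theorem boundaryTerm_im_of_isEpsDart {P : List HV} (hP : IsMidWalk (stripV T L) P)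
    (hε : IsEpsDart L (finalDart P)) :
    (edir (finalDart P).1 (finalDart P).2 * lam ^ pturn P / emb (-1, 2)).im =
      if (finalDart P).2.1 = (finalDart P).1.1 then Real.sin (π / 4) else -Real.sin (π / 4) := by
  have h0 := pturn_of_isEpsDart hP hε
  rcases hP.trivial_or_exists with rfl | ⟨l, u, hl, rfl⟩
  · exfalso; rcases hε.2 with ⟨-, h⟩ | ⟨-, h⟩ <;> simp [finalDart, wOut, hvOrigin] at h
  rw [finalDart_cons_append hl]
  rw [finalDart_cons_append hl] at hε h0
  obtain ⟨h2, hε⟩ := hε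
  dsimp only at h2 hε h0 ⊢
  have hposv : pos (l.getLast hl) = (3 * (l.getLast hl).1 + 2, 3 * (l.getLast hl).2.1 + 2) := by
    simp [pos, h2]
  rcases hε with ⟨-, h3⟩ | ⟨-, h3⟩
  · -- left cut
    rcases h0 with ⟨h0', h0⟩ | ⟨h0, -⟩
    swap; · exfalso; rw [h3] at h0; simp at h0
    have he : edir (l.getLast hl) u = omg ^ 2 * emb (-1, 2) := by
      rw [edir, h3, hposv, ← emb_neg_one_neg_one]
      simp only [pos, Bool.false_eq_true, if_false]
      congr 1; simp only [Prod.mk_sub_mk, Prod.mk.injEq]; constructor <;> ring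
    rw [if_pos h0', h0, he, mul_div_right_comm, mul_div_assoc, div_self emb_neg_one_two_ne_zero,
      mul_one, omg_sq, ← lam_zpow_sixteen, ← zpow_add₀ lam_ne_zero, lam_zpow_im,
      show (((16 + 2 : ℤ)) : ℝ) = 18 by norm_num]
    exact sin_eighteen_mul_θ₅
  · -- right cut
    rcases h0 with ⟨h0, -⟩ | ⟨h0', h0⟩
    · exfalso; rw [h3] at h0; simp at h0
    have hne : ¬ (u.1 = (l.getLast hl).1) := by rw [h0']; simp
    have he : edir (l.getLast hl) u = -omg * emb (-1, 2) := by
      rw [edir, h3, hposv, ← emb_two_neg_one]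
      simp only [pos, Bool.false_eq_true, if_false]
      congr 1; simp only [Prod.mk_sub_mk, Prod.mk.injEq]; constructor <;> ring
    have h32 : -omg = lam ^ (32 : ℤ) := by
      rw [show (32 : ℤ) = 16 + 16 by norm_num, zpow_add₀ lam_ne_zero, lam_zpow_sixteen, ← omg_sq,
        ← pow_add, show 2 + 2 = 3 + 1 by norm_num, pow_add, omg_pow_three]; ring
    rw [if_neg hne, h0, he, mul_div_right_comm, mul_div_assoc, div_self emb_neg_one_two_ne_zero,
      mul_one, h32, ← zpow_add₀ lam_ne_zero, lam_zpow_im, show (((32 + -2 : ℤ)) : ℝ) = 30 by norm_num]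
    exact sin_thirty_mul_θ₅

/-- The boundary term of the summed vertex relation, divided by `e₀`, has imaginary part
`x_c^{ℓ} · Im(boundary term / e₀)`. [folklore] -/
theorem im_div_e₀ (P : List HV) :
    (edir (finalDart P).1 (finalDart P).2 * pwt P / emb (-1, 2)).im =
      hexCriticalFugacity ^ mwLen P *
        (edir (finalDart P).1 (finalDart P).2 * lam ^ pturn P / emb (-1, 2)).im := by
  rw [pwt, show edir (finalDart P).1 (finalDart P).2 *
      ((hexCriticalFugacity : ℂ) ^ mwLen P * lam ^ pturn P) / emb (-1, 2) =
        ((hexCriticalFugacity ^ mwLen P : ℝ) : ℂ) *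
          (edir (finalDart P).1 (finalDart P).2 * lam ^ pturn P / emb (-1, 2)) by push_cast; ring]
  exact Complex.im_ofReal_mul _ _

/-! ### The imaginary identity and the one-sided bound -/

/-- **The imaginary part of DCS's identity (5)**: with `A⁺ = Σ_{α, k>0} x_c^ℓ`, `A⁻ = Σ_{α, k<0}`,
`E_ℓ`, `E_r` the masses through the left / right cut,
`sin(3π/8)·(A⁻ − A⁺) + sin(π/4)·(E_ℓ − E_r) = 0`, i.e.
`Σ_P x_c^{ℓ(P)} · [α: -sign(k) sin(3π/8); ε: ±sin(π/4)] = 0`.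
[cite: DuminilCopinSmirnov2012, proof of Lemma 2 (identity (5))] -/
theorem strip_imaginary_identity (hT : 1 ≤ T) (L : ℕ) :
    ∑ P ∈ midWalks (stripV T L), hexCriticalFugacity ^ mwLen P *
      ((if IsAlphaDart (finalDart P) then -(Int.sign (finalDart P).1.1 : ℝ) * Real.sin (3 * π / 8)
        else 0) +
       (if IsEpsDart L (finalDart P) then
          (if (finalDart P).2.1 = (finalDart P).1.1 then Real.sin (π / 4) else -Real.sin (π / 4))
        else 0)) = 0 := by
  have hbs := boundary_sum (V := stripV T L) stripV_upper (hvOrigin_mem_stripV hT)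
  rw [edir_wOut_hvOrigin, Finset.sum_filter] at hbs
  have hpt : ∀ P ∈ midWalks (stripV T L),
      ((if P ≠ [wOut, hvOrigin] ∧ (finalDart P).2 ∉ stripV T L then
          edir (finalDart P).1 (finalDart P).2 * pwt P else 0) / emb (-1, 2)).im =
        hexCriticalFugacity ^ mwLen P *
          ((if IsAlphaDart (finalDart P) then
              -(Int.sign (finalDart P).1.1 : ℝ) * Real.sin (3 * π / 8) else 0) +
            (if IsEpsDart L (finalDart P) then
              (if (finalDart P).2.1 = (finalDart P).1.1 then Real.sin (π / 4)
                else -Real.sin (π / 4)) else 0)) := by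
    intro P hP
    rw [mem_midWalks_iff] at hP
    have hiff := boundary_iff hT hP
    by_cases hα : IsAlphaDart (finalDart P)
    · rw [if_pos (hiff.2 (Or.inl hα)), im_div_e₀, boundaryTerm_im_of_isAlphaDart hP hα, if_pos hα,
        if_neg (not_isEpsDart_of_isAlphaDart hα)]
      ring
    by_cases hβ : IsBetaDart T (finalDart P)
    · rw [if_pos (hiff.2 (Or.inr (Or.inl hβ))), im_div_e₀, boundaryTerm_of_isBetaDart hP hβ,
        Complex.one_im, if_neg hα, if_neg (not_isEpsDart_of_isBetaDart hβ)]
      ring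
    by_cases hε : IsEpsDart L (finalDart P)
    · rw [if_pos (hiff.2 (Or.inr (Or.inr hε))), im_div_e₀, boundaryTerm_im_of_isEpsDart hP hε,
        if_neg hα, if_pos hε]
      ring
    · rw [if_neg (by rw [hiff]; push Not; exact ⟨hα, hβ, hε⟩), zero_div, Complex.zero_im,
        if_neg hα, if_neg hε]
      ring
  have key := congrArg (fun z => (z / emb (-1, 2)).im) hbs
  rw [div_self emb_neg_one_two_ne_zero, Complex.one_im, Finset.sum_div, Complex.im_sum,
    Finset.sum_congr rfl hpt] at key
  exact key

/-- The elementary inequality behind the one-sided bound: if `c (X + Y) + B + c' E ≤ 1`-type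
budget and the imaginary balance `s X − s Y ≤ c' E` hold with `0 < c < s`, `c' E ≥ 0`, then
`X ≤ 1/(2c)`. [folklore] -/
theorem halfSide_le_of_budget {c s c' X Y E : ℝ} (hc : 0 < c) (hcs : c < s)
    (hE : 0 ≤ c' * E) (h1 : c * (X + Y) + c' * E ≤ 1) (h2 : s * X - s * Y ≤ c' * E) :
    X ≤ 1 / (2 * c) := by
  rw [le_div_iff₀ (by linarith)]
  have hY' : c * Y ≤ 1 - c * X - c' * E := by linarith
  have hsc : 0 ≤ s - c := by linarith
  nlinarith [mul_le_mul_of_nonneg_left hY' hsc]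

/-- **One-sided arrival mass in the strip**: for every strip `S_{T,L}` (`T ≥ 1`) the critical
arrival mass on EACH side of the root separately is at most `1/(2cos(3π/8))`:
`Σ_{γ ⊂ S_{T,L}: a → α, exit column k with sign s} x_c^{ℓ(γ)} ≤ 1/(2cos(3π/8))` for `s = 1` and for
`s = -1`.  Proof: Lemma 2 gives `c_α(A⁺ + A⁻) + B + c_ε(E_ℓ + E_r) = 1`; the imaginary identity gives
`s_α|A⁺ − A⁻| = s_ε|E_ℓ − E_r| ≤ c_ε(E_ℓ + E_r) ≤ 1 − c_α(A⁺ + A⁻)` (`s_ε = c_ε`, `B ≥ 0`); hence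
`(s_α + c_α)A⁺ ≤ 1 + (s_α − c_α)A⁻ ≤ 1 + (s_α − c_α)(1/c_α − A⁺)` (`s_α > c_α`), i.e.
`2 s_α A⁺ ≤ s_α / c_α`. [cite: DuminilCopinSmirnov2012, Lemma 2 and its proof (identity (5))] -/
theorem strip_halfSide_arrival_le (hT : 1 ≤ T) (L : ℕ) (s : ℤ) (hs : s = 1 ∨ s = -1) :
    ∑ P ∈ (midWalks (stripV T L)).filter
        (fun P => IsAlphaDart (finalDart P) ∧ Int.sign (finalDart P).1.1 = s),
      hexCriticalFugacity ^ mwLen P ≤ 1 / (2 * Real.cos (3 * π / 8)) := by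
  -- notation for the four positive masses
  set M := midWalks (stripV T L) with hM
  set w : List HV → ℝ := fun P => hexCriticalFugacity ^ mwLen P with hw
  set Ap := ∑ P ∈ M.filter (fun P => IsAlphaDart (finalDart P) ∧ Int.sign (finalDart P).1.1 = 1),
    w P with hAp
  set Am := ∑ P ∈ M.filter (fun P => IsAlphaDart (finalDart P) ∧ Int.sign (finalDart P).1.1 = -1),
    w P with hAm
  set El := ∑ P ∈ M.filter (fun P => IsEpsDart L (finalDart P) ∧
    (finalDart P).2.1 = (finalDart P).1.1), w P with hEl
  set Er := ∑ P ∈ M.filter (fun P => IsEpsDart L (finalDart P) ∧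
    ¬ (finalDart P).2.1 = (finalDart P).1.1), w P with hEr
  have hxc : (0 : ℝ) ≤ hexCriticalFugacity := by unfold hexCriticalFugacity; positivity
  have hw0 : ∀ P, 0 ≤ w P := fun P => by rw [hw]; exact pow_nonneg hxc _
  have hAp0 : 0 ≤ Ap := Finset.sum_nonneg fun P _ => hw0 P
  have hAm0 : 0 ≤ Am := Finset.sum_nonneg fun P _ => hw0 P
  have hEl0 : 0 ≤ El := Finset.sum_nonneg fun P _ => hw0 P
  have hEr0 : 0 ≤ Er := Finset.sum_nonneg fun P _ => hw0 P
  -- A = Ap + Am (every alpha exit has a nonzero column), E = El + Er, B ≥ 0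
  have hA : stripA T L hexCriticalFugacity = Ap + Am := by
    have hsplit : ∀ P ∈ M.filter (fun P => IsAlphaDart (finalDart P)),
        (¬ Int.sign (finalDart P).1.1 = 1) ↔ Int.sign (finalDart P).1.1 = -1 := by
      intro P hP
      rw [Finset.mem_filter, mem_midWalks_iff] at hP
      have hk := (pturn_of_isAlphaDart hP.1 hP.2).1
      rcases lt_or_gt_of_ne hk with hk' | hk'
      · rw [Int.sign_eq_neg_one_of_neg hk']; decide
      · rw [Int.sign_eq_one_of_pos hk']; decide
    rw [stripA, ← Finset.sum_filter_add_sum_filter_not _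
      (fun P => Int.sign (finalDart P).1.1 = 1), Finset.filter_congr hsplit, Finset.filter_filter,
      Finset.filter_filter]
  have hE : stripE T L hexCriticalFugacity = El + Er := by
    rw [stripE, ← Finset.sum_filter_add_sum_filter_not _
      (fun P => (finalDart P).2.1 = (finalDart P).1.1), Finset.filter_filter, Finset.filter_filter]
  have hB : 0 ≤ stripB T L hexCriticalFugacity :=
    Finset.sum_nonneg fun P _ => pow_nonneg hxc _
  -- Lemma 2 (real part) and the imaginary identity
  have hre := DuminilCopinSmirnov2012_lemma2_holds T L hT
  rw [hA, hE] at hre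
  have him := strip_imaginary_identity hT L
  -- rewrite the imaginary identity as  -s_α Ap + s_α Am + s_ε El - s_ε Er = 0
  have hfun : ∀ P ∈ M, w P *
      ((if IsAlphaDart (finalDart P) then -(Int.sign (finalDart P).1.1 : ℝ) * Real.sin (3 * π / 8)
        else 0) +
       (if IsEpsDart L (finalDart P) then
          (if (finalDart P).2.1 = (finalDart P).1.1 then Real.sin (π / 4) else -Real.sin (π / 4))
        else 0)) =
      -Real.sin (3 * π / 8) *
          (if IsAlphaDart (finalDart P) ∧ Int.sign (finalDart P).1.1 = 1 then w P else 0) +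
        Real.sin (3 * π / 8) *
          (if IsAlphaDart (finalDart P) ∧ Int.sign (finalDart P).1.1 = -1 then w P else 0) +
        Real.sin (π / 4) *
          (if IsEpsDart L (finalDart P) ∧ (finalDart P).2.1 = (finalDart P).1.1 then w P else 0) -
        Real.sin (π / 4) *
          (if IsEpsDart L (finalDart P) ∧ ¬ (finalDart P).2.1 = (finalDart P).1.1 then w P
            else 0) := by
    intro P hP
    rw [hM, mem_midWalks_iff] at hP
    by_cases hα : IsAlphaDart (finalDart P)
    · have hk := (pturn_of_isAlphaDart hP hα).1
      have hnε := not_isEpsDart_of_isAlphaDart (L := L) hα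
      rcases lt_or_gt_of_ne hk with hk' | hk'
      · have hs := Int.sign_eq_neg_one_of_neg hk'
        simp [hα, hnε, hs, mul_comm]
      · have hs := Int.sign_eq_one_of_pos hk'
        simp [hα, hnε, hs, mul_comm]
    · by_cases hε : IsEpsDart L (finalDart P)
      · by_cases hc : (finalDart P).2.1 = (finalDart P).1.1
        · simp [hα, hε, hc]; ring
        · simp [hα, hε, hc]; ring
      · simp [hα, hε]
  have him' : -Real.sin (3 * π / 8) * Ap + Real.sin (3 * π / 8) * Am +
      Real.sin (π / 4) * El - Real.sin (π / 4) * Er = 0 := by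
    rw [← him, Finset.sum_congr rfl hfun, Finset.sum_sub_distrib, Finset.sum_add_distrib,
      Finset.sum_add_distrib, ← Finset.mul_sum, ← Finset.mul_sum, ← Finset.mul_sum,
      ← Finset.mul_sum, hAp, hAm, hEl, hEr, Finset.sum_filter, Finset.sum_filter, Finset.sum_filter,
      Finset.sum_filter]
  -- the numerical facts
  have hc0 : 0 < Real.cos (3 * π / 8) := Real.cos_pos_of_mem_Ioo ⟨by linarith [Real.pi_pos],
    by linarith [Real.pi_pos]⟩
  have hsc : Real.cos (3 * π / 8) < Real.sin (3 * π / 8) := by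
    rw [← Real.cos_pi_div_two_sub]
    apply Real.cos_lt_cos_of_nonneg_of_le_pi_div_two <;> linarith [Real.pi_pos]
  have hs4 : Real.sin (π / 4) = Real.cos (π / 4) := by
    rw [Real.sin_pi_div_four, Real.cos_pi_div_four]
  have hc4 : 0 ≤ Real.cos (π / 4) := by rw [Real.cos_pi_div_four]; positivity
  have hEpos : 0 ≤ Real.cos (π / 4) * (El + Er) := mul_nonneg hc4 (add_nonneg hEl0 hEr0)
  have h1 : Real.cos (3 * π / 8) * (Ap + Am) + Real.cos (π / 4) * (El + Er) ≤ 1 := by linarith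
  rw [hs4] at him'
  rcases hs with rfl | rfl
  · change Ap ≤ 1 / (2 * Real.cos (3 * π / 8))
    refine halfSide_le_of_budget hc0 hsc hEpos h1 ?_
    nlinarith [mul_nonneg hc4 hEl0, mul_nonneg hc4 hEr0]
  · change Am ≤ 1 / (2 * Real.cos (3 * π / 8))
    refine halfSide_le_of_budget hc0 hsc hEpos (by rw [add_comm Am Ap]; exact h1) ?_
    nlinarith [mul_nonneg hc4 hEl0, mul_nonneg hc4 hEr0]

end HV

end Literature.Probability.RandomPlanarGeometry.SAW

end
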